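import Mathlib.RingTheory.PowerSeries.Basic
import Mathlib.RingTheory.Ideal.Quotient.Basic
import Mathlib.Algebra.BigOperators.Intervals
import Mathlib.Algebra.BigOperators.NatAntidiagonal
import Mathlib.Data.Nat.Choose.Basic
import Literature.NumberTheory.EllipticCurves.TunnellThetaCoefficients
import HarnessLib

/-!
# Tunnell's Theorem 1: the two `q`-expansions of `g` agree — proof via Jacobi's triple product

This file discharges the named fact
`Literature.NumberTheory.EllipticCurves.Tunnell1983_gCoeff'_eq_gCoeff` of
`Literature.NumberTheory.EllipticCurves.TunnellThetaCoefficients`: for every `n ∈ ℤ`,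
`c'(n) = c(n)`, where
`c(n) = ∑_{(4m+1)² + 8k² = n} (-1)^k` and `c'(n) = ∑_{(4m+1)² + 16k² = n} (-1)^{m+k}` are the
coefficients of the two expressions of the weight-one form `g` in Tunnell's Theorem 1
(J. B. Tunnell, Invent. Math. 72 (1983), p. 326: "`g = ∑ (-1)^{m+n} q^{(4m+1)²+16n²}
= ∑ (-1)ⁿ q^{(4m+1)²+8n²}`"). Tunnell obtains the equality by identifying both theta series (of
Hecke characters of `ℚ(i)` and of `ℚ(√-2)`) with the unique newform of level `128`
(Labesse–Langlands / Deligne–Serre); we follow instead the route of his Remark (p. 327: "Jacobi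
noticed that `g = q ∏ (1 - q^{8n})(1 - q^{16n})` and remarked on the two representations given in
Theorem 1"), i.e. Jacobi's triple product identity, in a finite, purely algebraic form.

## The argument

Since `(4m+1)² + 8k² = 8(2m²+m+k²) + 1` and `(4m+1)² + 16k² = 8(2m²+m+2k²) + 1`, and both `c`, `c'`
vanish off `n ≡ 1 (mod 8)`, `n ≥ 1` (proved in the statement file), the claim is the identity of
integer formal power series
`ψ(X) φ(-X) = ψ(-X) φ(-X²)`, where `ψ(±X) = ∑_{m ∈ ℤ} (±1)^m X^{2m²+m}` and
`φ(-X^c) = ∑_{k ∈ ℤ} (-1)^k X^{ck²}` (`gCoeff_eight_mul_add_one`, `gCoeff'_eight_mul_add_one`,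
`thetaSeries_psi_phi_eq`). All four factors are specialisations `y = X^a`, `z = ± X^b` of Jacobi's
`∑ z^m y^{m²} = ∏ (1 - y^{2i})(1 + z y^{2i-1})(1 + z⁻¹ y^{2i-1})` (Andrews, Thm 2.8), and both sides
regroup to `∏ (1 - Xⁿ)(1 - X²ⁿ)`. We never form an infinite product: everything is proved modulo
`X^D` for every `D` (`EqMod`), from

* the Gaussian binomials `[L choose k]_q` as ring elements defined by the `q`-Pascal rule
  (`qBinomial`; Andrews §3.3, (3.3.4)), their vanishing above the diagonal and the cleared closed
  form `(q;q)_k [k+j choose k]_q = ∏_{i<k} (1 - q^{j+1+i})` (`qPoch_mul_qBinomial`);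
* the finite `q`-binomial theorem of Rothe–Cauchy in homogenised form,
  `∏_{t<L} (u + w q^t) = ∑_{k+l=L} [L choose k]_q q^{k(k-1)/2} w^k u^l` in any commutative ring
  (`prod_add_mul_pow_eq_sum_qBinomial`; Andrews Thm 3.3, (3.3.6));
* its specialisation `L = 2n+2`, `q = X^{2a}`, `u = X^{a(2n+1)-b}`, `w = s = ±1` in `ℤ⟦X⟧`, which
  after splitting the product at `t = n+1`, reflecting the first half and cancelling `sⁿ⁺¹ X^E` is
  Cauchy's finite triple product `∏_{j≤n} (1 + sX^{a(2j+1)+b})(1 + sX^{a(2j+1)-b})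
  = ∑_k [2n+2 choose k]_{X^{2a}} s^{|k-n-1|} X^{a(k-n-1)² + b(k-n-1)}`
  (`cauchyThetaProd_eq_sum_qBinomial`);
* the truncation `(X^{2a};X^{2a})_M · (Cauchy product) ≡ ∑_m s^{|m|} X^{am²+bm} (mod X^D)` for
  `n + 1 ≥ 2D`, `M ≥ n + 1 + D` (`eqMod_xPoch_mul_cauchyThetaProd`), because
  `(q;q)_M [2n+2 choose k]_q` is a product of factors `1 - q^j` with `j` large;
* the regrouping of the four finite products with the parameters `(2D, 4D)`, `(4D, 8D)`, which is an
  exact polynomial identity up to lengthening one Euler product (`thetaSeries_psi_phi_eq`).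

## Main statements

* `qBinomial`, `qPoch`, `qPoch_mul_qBinomial`, `prod_add_mul_pow_eq_sum_qBinomial` (Rothe–Cauchy).
* `EqMod D f g` (`f ≡ g mod X^D` on `R⟦X⟧`) and its algebra.
* `thetaSeries b e s = ∑_m s^{|m|} X^{(b+e)m² + bm}`, `cauchyThetaProd`, `xPoch`, and the truncated
  triple product `eqMod_xPoch_mul_cauchyThetaProd`; `coeff_thetaSeries_mul`.
* `thetaSeries_psi_phi_eq : ψ(X) φ(-X) = ψ(-X) φ(-X²)`.
* `Literature.NumberTheory.EllipticCurves.Tunnell1983_gCoeff'_eq_gCoeff_holds` — the discharge.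

## References

* J. B. Tunnell, *A classical Diophantine problem and modular forms of weight 3/2*, Invent. Math.
  72 (1983) 323–334, Theorem 1 (p. 326) and the Remark (p. 327); read on the GDZ scan
  `PPN356556735_0072` (pp. 326–327).
* G. E. Andrews, *The Theory of Partitions*, Encyclopedia Math. Appl. 2 (1976; CUP 1984):
  Thm 2.8, eq. (2.2.10) (Jacobi's triple product); §3.3 Def. 3.1, (3.3.4) (Gaussian polynomials,
  `q`-Pascal rule), Thm 3.3, eq. (3.3.6) (finite `q`-binomial theorem).

## Design

No topology and no infinite products: `EqMod D` is equality of the images in `R⟦X⟧ ⧸ (X^D)`, so it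
is a congruence for sums and products, and a power series identity is proved by proving it modulo
every `X^{D+1}`. The theta series are indexed like the statement file (`Tunnell1983.box`), so that
`gRep (8N+1)` is literally the filtered box of `coeff_thetaSeries_mul` (`gRep_eight_mul_add_one`).
-/

namespace Literature.NumberTheory.EllipticCurves.Tunnell1983

open Finset PowerSeries

section QBinomial

variable {R : Type*} [CommRing R]

/-- The Gaussian binomial coefficient (`q`-binomial, Gaussian polynomial evaluated at `q : R`)
`[L choose k]_q` as an element of `R`, defined by the `q`-Pascal rule
`[L+1, k+1]_q = q^(k+1) [L, k+1]_q + [L, k]_q`, `[L, 0]_q = 1`, `[0, k+1]_q = 0` (Andrews,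
*The Theory of Partitions*, §3.3, Def. 3.1 with (3.3.4)).
[cite: Andrews1976Partitions, §3.3 (3.3.4)] -/
def qBinomial (q : R) : ℕ → ℕ → R
  | _, 0 => 1
  | 0, _ + 1 => 0
  | L + 1, k + 1 => q ^ (k + 1) * qBinomial q L (k + 1) + qBinomial q L k

/-- `[L choose 0]_q = 1`. [cite: Andrews1976Partitions, §3.3 (3.3.1)] -/
@[simp] theorem qBinomial_zero_right (q : R) (L : ℕ) : qBinomial q L 0 = 1 := by
  cases L <;> rfl

/-- `[0 choose k+1]_q = 0`. [cite: Andrews1976Partitions, §3.3 Def. 3.1] -/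
@[simp] theorem qBinomial_zero_succ (q : R) (k : ℕ) : qBinomial q 0 (k + 1) = 0 := rfl

/-- The `q`-Pascal rule `[L+1, k+1]_q = q^(k+1) [L, k+1]_q + [L, k]_q`.
[cite: Andrews1976Partitions, §3.3 (3.3.4)] -/
theorem qBinomial_succ_succ (q : R) (L k : ℕ) :
    qBinomial q (L + 1) (k + 1) = q ^ (k + 1) * qBinomial q L (k + 1) + qBinomial q L k := rfl

/-- `[L choose k]_q = 0` for `k > L`. [cite: Andrews1976Partitions, §3.3 Def. 3.1] -/
theorem qBinomial_eq_zero_of_lt (q : R) {L k : ℕ} (h : L < k) : qBinomial q L k = 0 := by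
  induction L generalizing k with
  | zero =>
    obtain ⟨k, rfl⟩ := Nat.exists_eq_add_of_lt h
    simp
  | succ L ih =>
    obtain ⟨j, rfl⟩ := Nat.exists_eq_add_of_lt h
    rw [show L + 1 + j + 1 = (L + j + 1) + 1 by ring, qBinomial_succ_succ, ih (by omega),
      ih (by omega)]
    ring

/-- The `q`-Pochhammer symbol `(q)_k = (q; q)_k = ∏_{i<k} (1 - q^(i+1))` (Andrews, (2.1.2)).
[cite: Andrews1976Partitions, §3.3 Def. 3.1] -/
def qPoch (q : R) (k : ℕ) : R := ∏ i ∈ range k, (1 - q ^ (i + 1))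

/-- `(q;q)_{k+1} = (q;q)_k (1 - q^{k+1})`. [folklore] -/
theorem qPoch_succ (q : R) (k : ℕ) : qPoch q (k + 1) = qPoch q k * (1 - q ^ (k + 1)) :=
  prod_range_succ _ _

/-- **Closed form of the Gaussian binomial**, cleared of denominators:
`(q;q)_k [k+j choose k]_q = ∏_{i<k} (1 - q^{j+1+i}) = (q;q)_{k+j}/(q;q)_j` (Andrews, Def. 3.1:
`[n choose m] = (q)_n (q)_m⁻¹ (q)_{n-m}⁻¹`), proved from the `q`-Pascal rule alone, in any
commutative ring.
[cite: Andrews1976Partitions, §3.3 Def. 3.1] -/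
theorem qPoch_mul_qBinomial (q : R) (k j : ℕ) :
    qPoch q k * qBinomial q (k + j) k = ∏ i ∈ range k, (1 - q ^ (j + 1 + i)) := by
  suffices h : ∀ L k j : ℕ, k + j = L →
      qPoch q k * qBinomial q (k + j) k = ∏ i ∈ range k, (1 - q ^ (j + 1 + i)) from h _ _ _ rfl
  intro L
  induction L with
  | zero =>
    intro k j hkj
    obtain ⟨rfl, rfl⟩ : k = 0 ∧ j = 0 := by omega
    simp [qPoch]
  | succ L ih =>
    intro k j hkj
    cases k with
    | zero => simp [qPoch]
    | succ k =>
      rw [show k + 1 + j = (k + j) + 1 by ring, qBinomial_succ_succ, qPoch_succ]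
      by_cases hj : j = 0
      · subst hj
        rw [add_zero, qBinomial_eq_zero_of_lt q (Nat.lt_add_one k), mul_zero, zero_add]
        have h0 := ih k 0 (by omega)
        rw [add_zero] at h0
        rw [prod_range_succ, mul_right_comm, h0]
        congr 2
        ring
      · obtain ⟨j, rfl⟩ := Nat.exists_eq_add_one_of_ne_zero hj
        have h1 := ih (k + 1) j (by omega)
        have h2 := ih k (j + 1) (by omega)
        rw [show k + 1 + j = k + (j + 1) by ring] at h1
        calc qPoch q k * (1 - q ^ (k + 1)) * (q ^ (k + 1) * qBinomial q (k + (j + 1)) (k + 1)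
              + qBinomial q (k + (j + 1)) k)
            = q ^ (k + 1) * (qPoch q (k + 1) * qBinomial q (k + (j + 1)) (k + 1))
              + (1 - q ^ (k + 1)) * (qPoch q k * qBinomial q (k + (j + 1)) k) := by
              rw [qPoch_succ]; ring
          _ = q ^ (k + 1) * ∏ i ∈ range (k + 1), (1 - q ^ (j + 1 + i))
              + (1 - q ^ (k + 1)) * ∏ i ∈ range k, (1 - q ^ (j + 1 + 1 + i)) := by rw [h1, h2]
          _ = (∏ i ∈ range k, (1 - q ^ (j + 1 + 1 + i))) *
                (q ^ (k + 1) * (1 - q ^ (j + 1)) + (1 - q ^ (k + 1))) := by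
              rw [prod_range_succ']
              have : ∏ i ∈ range k, (1 - q ^ (j + 1 + (i + 1)))
                  = ∏ i ∈ range k, (1 - q ^ (j + 1 + 1 + i)) :=
                prod_congr rfl fun i _ ↦ by ring_nf
              rw [this]; ring
          _ = ∏ i ∈ range (k + 1), (1 - q ^ (j + 1 + 1 + i)) := by
              rw [prod_range_succ]
              have : q ^ (k + 1) * (1 - q ^ (j + 1)) + (1 - q ^ (k + 1))
                  = 1 - q ^ (j + 1 + 1 + k) := by ring
              rw [this]

/-- **The finite `q`-binomial theorem (Rothe, Cauchy), homogenised**, in any commutative ring: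
`∏_{t<L} (u + w q^t) = ∑_{k+l=L} [L choose k]_q q^{k(k-1)/2} w^k u^l` — Andrews, Thm 3.3, (3.3.6):
"`(z)_N = ∑_{j=0}^{N} [N choose j] (-1)^j z^j q^{j(j-1)/2}`" (the case `u = 1`, `w = -z`), proved by
induction on `L` (peel `t = 0`, replace `w` by `wq`, `q`-Pascal rule (3.3.4)).
[cite: Andrews1976Partitions, Thm 3.3 (3.3.6)] -/
theorem prod_add_mul_pow_eq_sum_qBinomial (L : ℕ) (u w q : R) :
    ∏ t ∈ range L, (u + w * q ^ t) =
      ∑ p ∈ antidiagonal L, qBinomial q L p.1 * q ^ (p.1.choose 2) * w ^ p.1 * u ^ p.2 := by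
  induction L generalizing w with
  | zero => simp
  | succ L ih =>
    have hsplit : (∑ p ∈ antidiagonal L,
          qBinomial q L p.1 * q ^ (p.1.choose 2 + p.1) * w ^ p.1 * u ^ (p.2 + 1))
        = u ^ (L + 1) + ∑ p ∈ antidiagonal L, qBinomial q L (p.1 + 1)
            * q ^ ((p.1 + 1).choose 2 + (p.1 + 1)) * w ^ (p.1 + 1) * u ^ p.2 := by
      have h := Finset.Nat.sum_antidiagonal_succ' (f := fun p : ℕ × ℕ ↦
        qBinomial q L p.1 * q ^ (p.1.choose 2 + p.1) * w ^ p.1 * u ^ p.2) (n := L)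
      rw [qBinomial_eq_zero_of_lt q (Nat.lt_add_one L)] at h
      simp only [zero_mul, zero_add] at h
      rw [← h, Finset.Nat.sum_antidiagonal_succ]
      simp
    calc ∏ t ∈ range (L + 1), (u + w * q ^ t)
        = (∏ t ∈ range L, (u + (w * q) * q ^ t)) * (u + w) := by
          rw [prod_range_succ']
          congr 1
          · exact prod_congr rfl fun t _ ↦ by ring
          · simp
      _ = (∑ p ∈ antidiagonal L,
            qBinomial q L p.1 * q ^ (p.1.choose 2 + p.1) * w ^ p.1 * u ^ p.2) * (u + w) := by
          rw [ih (w * q)]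
          congr 1
          exact sum_congr rfl fun p _ ↦ by ring
      _ = (∑ p ∈ antidiagonal L,
            qBinomial q L p.1 * q ^ (p.1.choose 2 + p.1) * w ^ p.1 * u ^ (p.2 + 1))
          + ∑ p ∈ antidiagonal L,
              qBinomial q L p.1 * q ^ (p.1.choose 2 + p.1) * w ^ (p.1 + 1) * u ^ p.2 := by
          rw [mul_add, sum_mul, sum_mul]
          congr 1 <;> exact sum_congr rfl fun p _ ↦ by ring
      _ = u ^ (L + 1) + ∑ p ∈ antidiagonal L,
            (qBinomial q L (p.1 + 1) * q ^ ((p.1 + 1).choose 2 + (p.1 + 1)) * w ^ (p.1 + 1)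
                * u ^ p.2
              + qBinomial q L p.1 * q ^ (p.1.choose 2 + p.1) * w ^ (p.1 + 1) * u ^ p.2) := by
          rw [hsplit, add_assoc, ← sum_add_distrib]
      _ = ∑ p ∈ antidiagonal (L + 1),
            qBinomial q (L + 1) p.1 * q ^ (p.1.choose 2) * w ^ p.1 * u ^ p.2 := by
          rw [Finset.Nat.sum_antidiagonal_succ]
          simp only [qBinomial_zero_right, qBinomial_succ_succ, Nat.choose_zero_succ, pow_zero,
            mul_one, one_mul]
          congr 1
          exact sum_congr rfl fun p _ ↦ by
            have hc : (p.1 + 1).choose 2 = p.1 + p.1.choose 2 := by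
              have h := Nat.choose_succ_succ' p.1 1
              rwa [Nat.choose_one_right] at h
            rw [hc]; ring

end QBinomial

section EqMod

variable {R : Type*} [CommRing R]

/-- `f ≡ g mod X^D`: the coefficients of `f` and `g` agree below degree `D`. [folklore] -/
def EqMod (D : ℕ) (f g : R⟦X⟧) : Prop := ∀ d < D, coeff d f = coeff d g

/-- `f ≡ g mod X^D` iff `f` and `g` have the same image in `R⟦X⟧ ⧸ (X^D)`. [folklore] -/
theorem eqMod_iff_mk_eq {D : ℕ} {f g : R⟦X⟧} :
    EqMod D f g ↔ Ideal.Quotient.mk (Ideal.span {(X : R⟦X⟧) ^ D}) f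
      = Ideal.Quotient.mk (Ideal.span {(X : R⟦X⟧) ^ D}) g := by
  rw [Ideal.Quotient.eq, Ideal.mem_span_singleton, X_pow_dvd_iff]
  simp only [map_sub, sub_eq_zero]
  rfl

/-- `≡ mod X^D` is reflexive. [folklore] -/
theorem EqMod.refl (D : ℕ) (f : R⟦X⟧) : EqMod D f f := fun _ _ ↦ rfl

/-- `≡ mod X^D` is symmetric. [folklore] -/
theorem EqMod.symm {D : ℕ} {f g : R⟦X⟧} (h : EqMod D f g) : EqMod D g f :=
  fun d hd ↦ (h d hd).symm

/-- `≡ mod X^D` is transitive. [folklore] -/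
theorem EqMod.trans {D : ℕ} {f g k : R⟦X⟧} (h : EqMod D f g) (h' : EqMod D g k) : EqMod D f k :=
  fun d hd ↦ (h d hd).trans (h' d hd)

/-- `≡ mod X^D` is multiplicative. [folklore] -/
theorem EqMod.mul {D : ℕ} {f g f' g' : R⟦X⟧} (h : EqMod D f g) (h' : EqMod D f' g') :
    EqMod D (f * f') (g * g') := by
  rw [eqMod_iff_mk_eq] at h h' ⊢
  rw [map_mul, map_mul, h, h']

/-- `≡ mod X^D` passes to finite products. [folklore] -/
theorem EqMod.prod {D : ℕ} {ι : Type*} (s : Finset ι) {f g : ι → R⟦X⟧}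
    (h : ∀ i ∈ s, EqMod D (f i) (g i)) : EqMod D (∏ i ∈ s, f i) (∏ i ∈ s, g i) := by
  simp only [eqMod_iff_mk_eq] at h ⊢
  rw [map_prod, map_prod]
  exact prod_congr rfl h

/-- `1 - X^e ≡ 1 mod X^D` for `e ≥ D`. [folklore] -/
theorem eqMod_one_sub_X_pow {D e : ℕ} (he : D ≤ e) : EqMod D (1 - (X : R⟦X⟧) ^ e) 1 := by
  intro d hd
  rw [map_sub, coeff_X_pow, if_neg (by omega), sub_zero]

/-- A product of factors `1 - X^(e i)` with all `e i ≥ D` is `≡ 1 mod X^D`. [folklore] -/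
theorem eqMod_prod_one_sub_X_pow {D : ℕ} {ι : Type*} (s : Finset ι) (e : ι → ℕ)
    (he : ∀ i ∈ s, D ≤ e i) : EqMod D (∏ i ∈ s, (1 - (X : R⟦X⟧) ^ e i)) 1 := by
  have h := EqMod.prod s (f := fun i ↦ 1 - (X : R⟦X⟧) ^ e i) (g := fun _ ↦ 1)
    fun i hi ↦ eqMod_one_sub_X_pow (he i hi)
  rwa [prod_const_one] at h

end EqMod

section Theta

/-! ### Truncated triple-product specialisations -/

/-- The exponent `a m² + b m` (`a = b + e`) as a natural number. [folklore] -/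
def thetaExp (b e : ℕ) (m : ℤ) : ℕ := (((b : ℤ) + e) * m ^ 2 + b * m).toNat

/-- `a m² + b m ≥ 0` for `a ≥ b ≥ 0`. [folklore] -/
theorem thetaExp_aux_nonneg (b e : ℕ) (m : ℤ) : 0 ≤ ((b : ℤ) + e) * m ^ 2 + b * m := by
  rcases le_or_gt 0 m with hm | hm
  · positivity
  · have h1 : ((b : ℤ) + e) * m + b ≤ 0 := by nlinarith
    nlinarith

/-- `thetaExp b e m = a m² + b m` in `ℤ` (`a = b + e`). [folklore] -/
theorem cast_thetaExp (b e : ℕ) (m : ℤ) :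
    (thetaExp b e m : ℤ) = ((b : ℤ) + e) * m ^ 2 + b * m := by
  rw [thetaExp, Int.toNat_of_nonneg (thetaExp_aux_nonneg b e m)]

/-- `|m| ≤ a m² + b m` when `a > b` (the box `[-d, d]` loses no solution of `a m² + b m = d`).
[folklore] -/
theorem natAbs_le_thetaExp (b : ℕ) {e : ℕ} (he : 1 ≤ e) (m : ℤ) : m.natAbs ≤ thetaExp b e m := by
  have h := cast_thetaExp b e m
  rcases le_or_gt 0 m with hm | hm
  · have h1 : m ≤ ((b : ℤ) + e) * m ^ 2 + b * m := by nlinarith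
    omega
  · have he' : (1 : ℤ) ≤ e := by exact_mod_cast he
    have h2 : ((b : ℤ) + e) * m ≤ -((b : ℤ) + e) := by nlinarith
    have h3 : ((b : ℤ) + e) * m + b + 1 ≤ 0 := by linarith
    have h4 : 0 ≤ m * (((b : ℤ) + e) * m + b + 1) := mul_nonneg_of_nonpos_of_nonpos (by omega) h3
    have h1 : -m ≤ ((b : ℤ) + e) * m ^ 2 + b * m := by nlinarith [h4]
    omega

/-- For `s = ±1`: `s^p = s^q` whenever `p ≡ q (mod 2)`. [folklore] -/
theorem pow_eq_pow_of_mod_two {M : Type*} [Monoid M] {s : M} (hs : s * s = 1) {p q : ℕ}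
    (h : p % 2 = q % 2) : s ^ p = s ^ q := by
  have key : ∀ r : ℕ, s ^ r = s ^ (r % 2) := fun r ↦ by
    conv_lhs => rw [← Nat.div_add_mod r 2, pow_add, pow_mul]
    rw [pow_two, hs, one_pow, one_mul]
  rw [key p, key q, h]

variable (b e : ℕ) (s : ℤ)

/-- `θ_{a,b,s} = ∑_{m ∈ ℤ} s^{|m|} X^{a m² + b m}` (`a = b + e`) as an integer power series, through
its coefficients (finite sums over the box `[-d, d]`). [folklore] -/
noncomputable def thetaSeries : ℤ⟦X⟧ :=
  PowerSeries.mk fun d ↦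
    ∑ m ∈ (box d).filter (fun m : ℤ ↦ ((b : ℤ) + e) * m ^ 2 + b * m = d), s ^ m.natAbs

/-- Cauchy's finite product `∏_{j<n} (1 + s X^{a(2j+1)+b}) (1 + s X^{a(2j+1)-b})`, `a = b + e`
(the truncation of `∏ (1 + z y^{2j-1})(1 + z⁻¹ y^{2j-1})` at `y = X^a`, `z = s X^b`). [folklore] -/
noncomputable def cauchyThetaProd (n : ℕ) : ℤ⟦X⟧ :=
  ∏ j ∈ range n, ((1 + C s * X ^ ((b + e) * (2 * j + 1) + b)) *
    (1 + C s * X ^ (2 * b * j + e * (2 * j + 1))))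

/-- The finite Euler product `∏_{i<M} (1 - X^{c(i+1)})`. [folklore] -/
noncomputable def xPoch (c M : ℕ) : ℤ⟦X⟧ := ∏ i ∈ range M, (1 - X ^ (c * (i + 1)))

/-- `(X^c; X^c)_M = ∏_{i<M} (1 - X^{c(i+1)})`. [folklore] -/
theorem qPoch_X_pow (c M : ℕ) : qPoch ((X : ℤ⟦X⟧) ^ c) M = xPoch c M :=
  prod_congr rfl fun i _ ↦ by rw [← pow_mul]

variable {s}

/-- `C s · C s = 1` for `s = ±1`. [folklore] -/
theorem C_mul_C (hs : s * s = 1) : (C s : ℤ⟦X⟧) * C s = 1 := by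
  rw [← map_mul, hs, map_one]

/-- The factors `t < n+1` of Rothe's product, reflected:
`X^c + s X^{2a i} = s X^{2a i} (1 + s X^{a(2j+1)-b})` for `c = a(2(i+j)+1) - b`. [folklore] -/
private theorem factor_reflect (hs : s * s = 1) (i j : ℕ) :
    (X : ℤ⟦X⟧) ^ (2 * b * (i + j) + e * (2 * (i + j) + 1)) + C s * (X ^ (2 * (b + e))) ^ i
      = C s * X ^ (2 * (b + e) * i) * (1 + C s * X ^ (2 * b * j + e * (2 * j + 1))) := by
  have hX : (X : ℤ⟦X⟧) ^ (2 * b * (i + j) + e * (2 * (i + j) + 1))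
      = X ^ (2 * (b + e) * i) * X ^ (2 * b * j + e * (2 * j + 1)) := by
    rw [← pow_add]; congr 1; ring
  rw [hX, ← pow_mul]
  linear_combination (-(X ^ (2 * (b + e) * i) * X ^ (2 * b * j + e * (2 * j + 1)))) * C_mul_C hs

/-- The factors `t ≥ n+1` of Rothe's product: `X^c + s X^{2a(n+1+j)} = X^c (1 + s X^{a(2j+1)+b})`,
`c = a(2n+1) - b`. [folklore] -/
private theorem factor_shift (n j : ℕ) :
    (X : ℤ⟦X⟧) ^ (2 * b * n + e * (2 * n + 1)) + C s * (X ^ (2 * (b + e))) ^ (n + 1 + j)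
      = X ^ (2 * b * n + e * (2 * n + 1)) * (1 + C s * X ^ ((b + e) * (2 * j + 1) + b)) := by
  have hX : ((X : ℤ⟦X⟧) ^ (2 * (b + e))) ^ (n + 1 + j)
      = X ^ (2 * b * n + e * (2 * n + 1)) * X ^ ((b + e) * (2 * j + 1) + b) := by
    rw [← pow_mul, ← pow_add]; congr 1; ring
  rw [hX]; ring

/-- `∑_{j≤n} a(n-j) = ∑_{j≤n} a j`. [folklore] -/
theorem sum_range_succ_mul_sub (a n : ℕ) :
    ∑ j ∈ range (n + 1), a * (n - j) = ∑ j ∈ range (n + 1), a * j := by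
  have h := sum_range_reflect (fun j ↦ a * j) (n + 1)
  simpa using h

/-- Gauss: `2 ∑_{j≤n} j = (n+1) n`. [folklore] -/
theorem two_mul_sum_range_succ (n : ℕ) : 2 * ∑ j ∈ range (n + 1), j = (n + 1) * n := by
  have h := sum_range_id_mul_two (n + 1)
  simp only [Nat.add_sub_cancel] at h
  omega

/-- The product side of Rothe's theorem at `L = 2(n+1)`, `q = X^{2a}`, `u = X^c`
(`c = a(2n+1) - b`), `w = s`: it is `sⁿ⁺¹ X^E · cauchyThetaProd (n+1)`. [folklore] -/
theorem rothe_prod_eq (hs : s * s = 1) (n : ℕ) :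
    ∏ t ∈ range (n + 1 + (n + 1)),
        ((X : ℤ⟦X⟧) ^ (2 * b * n + e * (2 * n + 1)) + C s * (X ^ (2 * (b + e))) ^ t)
      = C s ^ (n + 1) * X ^ ((b + e) * ((n + 1) * n) + (2 * b * n + e * (2 * n + 1)) * (n + 1))
          * cauchyThetaProd b e s (n + 1) := by
  rw [prod_range_add]
  have h1 : ∏ t ∈ range (n + 1),
      ((X : ℤ⟦X⟧) ^ (2 * b * n + e * (2 * n + 1)) + C s * (X ^ (2 * (b + e))) ^ t)
      = ∏ j ∈ range (n + 1),
          (C s * X ^ (2 * (b + e) * (n - j)) * (1 + C s * X ^ (2 * b * j + e * (2 * j + 1)))) := by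
    rw [← prod_range_reflect]
    refine prod_congr rfl fun j hj ↦ ?_
    rw [Finset.mem_range] at hj
    have h := factor_reflect b e hs (n - j) j
    rw [show n - j + j = n by omega] at h
    rw [show n + 1 - 1 - j = n - j by omega, h]
  have h2 : ∏ t ∈ range (n + 1),
      ((X : ℤ⟦X⟧) ^ (2 * b * n + e * (2 * n + 1)) + C s * (X ^ (2 * (b + e))) ^ (n + 1 + t))
      = ∏ j ∈ range (n + 1),
          (X ^ (2 * b * n + e * (2 * n + 1)) * (1 + C s * X ^ ((b + e) * (2 * j + 1) + b))) :=
    prod_congr rfl fun j _ ↦ factor_shift b e n j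
  have hsum : ∑ j ∈ range (n + 1), 2 * (b + e) * (n - j) = (b + e) * ((n + 1) * n) := by
    rw [sum_range_succ_mul_sub, ← mul_sum, mul_assoc, mul_left_comm, two_mul_sum_range_succ]
  rw [h1, h2, prod_mul_distrib, prod_mul_distrib, prod_mul_distrib, prod_const, prod_const,
    card_range, prod_pow_eq_pow_sum, hsum, cauchyThetaProd, prod_mul_distrib]
  ring

/-- `2 (k choose 2) = k (k - 1)` in `ℤ`. [folklore] -/
theorem two_mul_choose_two_cast (k : ℕ) : (2 * (k.choose 2 : ℕ) : ℤ) = k * (k - 1) := by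
  induction k with
  | zero => simp
  | succ k ih =>
    have hc : (k + 1).choose 2 = k + k.choose 2 := by
      have h := Nat.choose_succ_succ' k 1
      rwa [Nat.choose_one_right] at h
    rw [hc]
    push_cast at ih ⊢
    linear_combination ih

/-- The sum side of Rothe's theorem at `L = 2(n+1)`, `q = X^{2a}`, `u = X^c`, `w = s`: it is
`sⁿ⁺¹ X^E ∑_k [2n+2 choose k] s^{|k-n-1|} X^{a(k-n-1)² + b(k-n-1)}`. [folklore] -/
theorem rothe_sum_eq (hs : s * s = 1) (n : ℕ) :
    ∑ p ∈ antidiagonal (n + 1 + (n + 1)),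
        qBinomial ((X : ℤ⟦X⟧) ^ (2 * (b + e))) (n + 1 + (n + 1)) p.1
          * (X ^ (2 * (b + e))) ^ (p.1.choose 2) * C s ^ p.1
          * (X ^ (2 * b * n + e * (2 * n + 1))) ^ p.2
      = C s ^ (n + 1) * X ^ ((b + e) * ((n + 1) * n) + (2 * b * n + e * (2 * n + 1)) * (n + 1))
          * ∑ p ∈ antidiagonal (n + 1 + (n + 1)),
              qBinomial ((X : ℤ⟦X⟧) ^ (2 * (b + e))) (n + 1 + (n + 1)) p.1 *
                (C (s ^ ((p.1 : ℤ) - (n + 1)).natAbs)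
                  * X ^ thetaExp b e ((p.1 : ℤ) - (n + 1))) := by
  rw [mul_sum]
  refine sum_congr rfl fun p hp ↦ ?_
  rw [mem_antidiagonal] at hp
  obtain ⟨k, l⟩ := p
  dsimp only at hp ⊢
  have hsign : s ^ k = s ^ (n + 1) * s ^ ((k : ℤ) - (n + 1)).natAbs := by
    rw [← pow_add]; exact pow_eq_pow_of_mod_two hs (by omega)
  have hexp : 2 * (b + e) * k.choose 2 + (2 * b * n + e * (2 * n + 1)) * l
      = (b + e) * ((n + 1) * n) + (2 * b * n + e * (2 * n + 1)) * (n + 1)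
        + thetaExp b e ((k : ℤ) - (n + 1)) := by
    have h2C := two_mul_choose_two_cast k
    have hθ := cast_thetaExp b e ((k : ℤ) - (n + 1))
    have hl : (l : ℤ) = 2 * n + 2 - k := by omega
    zify
    rw [hθ, hl]
    linear_combination ((b : ℤ) + e) * h2C
  have hX : (X : ℤ⟦X⟧) ^ (2 * (b + e) * k.choose 2) * X ^ ((2 * b * n + e * (2 * n + 1)) * l)
      = X ^ ((b + e) * ((n + 1) * n) + (2 * b * n + e * (2 * n + 1)) * (n + 1))
        * X ^ thetaExp b e ((k : ℤ) - (n + 1)) := by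
    rw [← pow_add, hexp, pow_add]
  rw [← pow_mul, ← pow_mul, ← map_pow, hsign, map_mul, map_pow]
  linear_combination (qBinomial ((X : ℤ⟦X⟧) ^ (2 * (b + e))) (n + 1 + (n + 1)) k * C s ^ (n + 1)
    * C (s ^ ((k : ℤ) - (n + 1)).natAbs)) * hX

/-- **Cauchy's finite triple product, specialised** (`y = X^a`, `z = s X^b`, `a = b + e`):
`∏_{j<n+1} (1 + sX^{a(2j+1)+b})(1 + sX^{a(2j+1)-b})
  = ∑_k [2n+2 choose k]_{X^{2a}} s^{|k-n-1|} X^{a(k-n-1)² + b(k-n-1)}`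
(the finite form of Jacobi's triple product, Andrews Thm 2.8, before letting `n → ∞`).
[cite: Andrews1976Partitions, Thm 3.3 (3.3.6)] -/
theorem cauchyThetaProd_eq_sum_qBinomial (hs : s * s = 1) (n : ℕ) :
    cauchyThetaProd b e s (n + 1) = ∑ p ∈ antidiagonal (n + 1 + (n + 1)),
        qBinomial ((X : ℤ⟦X⟧) ^ (2 * (b + e))) (n + 1 + (n + 1)) p.1 *
          (C (s ^ ((p.1 : ℤ) - (n + 1)).natAbs) * X ^ thetaExp b e ((p.1 : ℤ) - (n + 1))) := by
  have h := prod_add_mul_pow_eq_sum_qBinomial (n + 1 + (n + 1))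
    ((X : ℤ⟦X⟧) ^ (2 * b * n + e * (2 * n + 1))) (C s) (X ^ (2 * (b + e)))
  rw [rothe_prod_eq b e hs n, rothe_sum_eq b e hs n] at h
  have hC : C s ^ (n + 1) * C s ^ (n + 1) = (1 : ℤ⟦X⟧) := by
    rw [← mul_pow, C_mul_C hs, one_pow]
  rw [mul_assoc (C s ^ (n + 1)) (X ^ _) (cauchyThetaProd b e s (n + 1)),
    mul_assoc (C s ^ (n + 1)) (X ^ _) (∑ p ∈ antidiagonal (n + 1 + (n + 1)), _)] at h
  exact X_pow_mul_cancel ((IsUnit.of_mul_eq_one _ hC).mul_left_cancel h)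

/-- `(q;q)_M [k+j choose k]_q ≡ 1 mod X^D` for `q = X^c` when `c(k+1) ≥ D`, `c(j+1) ≥ D` and
`k ≤ M`: it is `∏_{i<M-k}(1 - q^{k+1+i}) ∏_{i<k}(1 - q^{j+1+i})`. [folklore] -/
theorem eqMod_qPoch_mul_qBinomial {c k j M D : ℕ} (hkM : k ≤ M) (hk : D ≤ c * (k + 1))
    (hj : D ≤ c * (j + 1)) :
    EqMod D (qPoch ((X : ℤ⟦X⟧) ^ c) M * qBinomial ((X : ℤ⟦X⟧) ^ c) (k + j) k) 1 := by
  obtain ⟨r, rfl⟩ := Nat.exists_eq_add_of_le hkM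
  have hsplit : qPoch ((X : ℤ⟦X⟧) ^ c) (k + r)
      = qPoch ((X : ℤ⟦X⟧) ^ c) k * ∏ i ∈ range r, (1 - X ^ (c * (k + i + 1))) := by
    rw [qPoch, prod_range_add]
    congr 1
    exact prod_congr rfl fun i _ ↦ by rw [← pow_mul]
  have hp : ∏ i ∈ range k, (1 - ((X : ℤ⟦X⟧) ^ c) ^ (j + 1 + i))
      = ∏ i ∈ range k, (1 - X ^ (c * (j + 1 + i))) :=
    prod_congr rfl fun i _ ↦ by rw [← pow_mul]
  rw [hsplit, mul_right_comm, qPoch_mul_qBinomial, hp]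
  have h1 := eqMod_prod_one_sub_X_pow (R := ℤ) (D := D) (range k) (fun i ↦ c * (j + 1 + i))
    (fun i _ ↦ le_trans hj (Nat.mul_le_mul_left _ (by omega)))
  have h2 := eqMod_prod_one_sub_X_pow (R := ℤ) (D := D) (range r) (fun i ↦ c * (k + i + 1))
    (fun i _ ↦ le_trans hk (Nat.mul_le_mul_left _ (by omega)))
  have h := h1.mul h2
  rwa [mul_one] at h

variable {b e}

/-- **Truncated triple product, specialised** (`y = X^a`, `z = sX^b`, `a = b + e ≥ b + 1`):
`∑_m s^{|m|} X^{am²+bm}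
  ≡ ∏_{i<M}(1 - X^{2a(i+1)}) · ∏_{j≤n}(1 + sX^{a(2j+1)+b})(1 + sX^{a(2j+1)-b})`
modulo `X^D`, as soon as `n + 1 ≥ 2D` and `M ≥ n + 1 + D`. [folklore] -/
theorem eqMod_xPoch_mul_cauchyThetaProd_succ (he : 1 ≤ e) (hs : s * s = 1) {D n M : ℕ}
    (hn : 2 * D ≤ n + 1) (hM : n + 1 + D ≤ M) :
    EqMod D (xPoch (2 * (b + e)) M * cauchyThetaProd b e s (n + 1)) (thetaSeries b e s) := by
  intro d hd
  rw [cauchyThetaProd_eq_sum_qBinomial b e hs n, mul_sum, map_sum, thetaSeries, coeff_mk]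
  have hterm : ∀ p ∈ antidiagonal (n + 1 + (n + 1)),
      coeff d (xPoch (2 * (b + e)) M *
        (qBinomial ((X : ℤ⟦X⟧) ^ (2 * (b + e))) (n + 1 + (n + 1)) p.1 *
          (C (s ^ ((p.1 : ℤ) - (n + 1)).natAbs) * X ^ thetaExp b e ((p.1 : ℤ) - (n + 1)))))
      = if thetaExp b e ((p.1 : ℤ) - (n + 1)) = d then s ^ ((p.1 : ℤ) - (n + 1)).natAbs else 0 := by
    intro p hp
    rw [mem_antidiagonal] at hp
    have hnat := natAbs_le_thetaExp b he ((p.1 : ℤ) - (n + 1))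
    rw [show xPoch (2 * (b + e)) M *
        (qBinomial ((X : ℤ⟦X⟧) ^ (2 * (b + e))) (n + 1 + (n + 1)) p.1 *
          (C (s ^ ((p.1 : ℤ) - (n + 1)).natAbs) * X ^ thetaExp b e ((p.1 : ℤ) - (n + 1))))
        = xPoch (2 * (b + e)) M * qBinomial ((X : ℤ⟦X⟧) ^ (2 * (b + e))) (n + 1 + (n + 1)) p.1 *
          C (s ^ ((p.1 : ℤ) - (n + 1)).natAbs) * X ^ thetaExp b e ((p.1 : ℤ) - (n + 1)) by ring,
      coeff_mul_X_pow']
    have hp1 : thetaExp b e ((p.1 : ℤ) - (n + 1)) ≤ d → D ≤ 2 * (b + e) * (p.1 + 1) :=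
      fun h ↦ le_trans (by omega) (Nat.le_mul_of_pos_left (p.1 + 1) (by omega))
    have hp2 : thetaExp b e ((p.1 : ℤ) - (n + 1)) ≤ d → D ≤ 2 * (b + e) * (p.2 + 1) :=
      fun h ↦ le_trans (by omega) (Nat.le_mul_of_pos_left (p.2 + 1) (by omega))
    split_ifs with h1 h2 h2
    · rw [coeff_mul_C, ← qPoch_X_pow, ← hp]
      have hg := eqMod_qPoch_mul_qBinomial (c := 2 * (b + e)) (k := p.1) (j := p.2) (M := M)
        (D := D) (by omega) (hp1 h1) (hp2 h1)
      rw [hg (d - thetaExp b e ((p.1 : ℤ) - (n + 1))) (by omega), coeff_one, if_pos (by omega),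
        one_mul]
    · rw [coeff_mul_C, ← qPoch_X_pow, ← hp]
      have hg := eqMod_qPoch_mul_qBinomial (c := 2 * (b + e)) (k := p.1) (j := p.2) (M := M)
        (D := D) (by omega) (hp1 h1) (hp2 h1)
      rw [hg (d - thetaExp b e ((p.1 : ℤ) - (n + 1))) (by omega), coeff_one, if_neg (by omega),
        zero_mul]
    · exfalso; omega
    · rfl
  rw [sum_congr rfl hterm, ← sum_filter]
  refine sum_nbij' (fun p ↦ (p.1 : ℤ) - (n + 1))
    (fun m ↦ ((m + (n + 1)).toNat, ((n + 1 : ℤ) - m).toNat)) ?_ ?_ ?_ ?_ ?_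
  · intro p hp
    simp only [Finset.mem_filter, mem_antidiagonal] at hp
    have hnat := natAbs_le_thetaExp b he ((p.1 : ℤ) - (n + 1))
    have hθ := cast_thetaExp b e ((p.1 : ℤ) - (n + 1))
    simp only [Finset.mem_filter, mem_box_iff_natAbs_le]
    refine ⟨by omega, ?_⟩
    rw [← hθ, hp.2]
  · intro m hm
    simp only [Finset.mem_filter, mem_box_iff_natAbs_le] at hm
    simp only [Finset.mem_filter, mem_antidiagonal]
    refine ⟨by omega, ?_⟩
    have hθ := cast_thetaExp b e m
    have h1 : (((m + (n + 1)).toNat : ℕ) : ℤ) - (n + 1) = m := by omega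
    rw [h1]
    have h2 : (thetaExp b e m : ℤ) = d := by rw [hθ, hm.2]
    exact_mod_cast h2
  · intro p hp
    simp only [Finset.mem_filter, mem_antidiagonal] at hp
    ext <;> simp only <;> omega
  · intro m hm
    simp only [Finset.mem_filter, mem_box_iff_natAbs_le] at hm
    omega
  · intro p hp
    rfl

/-- The truncated triple product with the Cauchy parameter `N ≥ 2D ≥ 2` (wrapper). [folklore] -/
theorem eqMod_xPoch_mul_cauchyThetaProd (he : 1 ≤ e) (hs : s * s = 1) {D N M : ℕ} (hD : 0 < D)
    (hN : 2 * D ≤ N) (hM : N + D ≤ M) :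
    EqMod D (xPoch (2 * (b + e)) M * cauchyThetaProd b e s N) (thetaSeries b e s) := by
  obtain ⟨n, rfl⟩ : ∃ n, N = n + 1 := ⟨N - 1, by omega⟩
  exact eqMod_xPoch_mul_cauchyThetaProd_succ he hs hN hM

end Theta

section Assembly

/-! ### `ψ(X) φ(-X) = ψ(-X) φ(-X²)`: regrouping the four product expansions -/

/-- Even/odd splitting of a product over `range (2K)`. [folklore] -/
theorem prod_range_two_mul {M : Type*} [CommMonoid M] (f : ℕ → M) (K : ℕ) :
    ∏ i ∈ range (2 * K), f i = ∏ j ∈ range K, (f (2 * j) * f (2 * j + 1)) := by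
  induction K with
  | zero => simp
  | succ K ih =>
    rw [show 2 * (K + 1) = 2 * K + 1 + 1 by ring, prod_range_succ, prod_range_succ, ih,
      prod_range_succ, mul_assoc]

/-- `ψ(±X)`-type Cauchy products: `∏_{j<K}(1 + sX^{4j+3})(1 + sX^{4j+1}) = ∏_{i<2K}(1 + sX^{2i+1})`.
[folklore] -/
theorem cauchyThetaProd_one_one (s : ℤ) (K : ℕ) :
    cauchyThetaProd 1 1 s K = ∏ i ∈ range (2 * K), (1 + C s * (X : ℤ⟦X⟧) ^ (2 * i + 1)) := by
  rw [prod_range_two_mul, cauchyThetaProd]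
  exact prod_congr rfl fun j _ ↦ by ring

/-- `φ(-X)`-type Cauchy product: `∏_{j<K}(1 - X^{2j+1})²`. [folklore] -/
theorem cauchyThetaProd_zero_one (K : ℕ) :
    cauchyThetaProd 0 1 (-1) K
      = ∏ j ∈ range K, ((1 - (X : ℤ⟦X⟧) ^ (2 * j + 1)) * (1 - X ^ (2 * j + 1))) := by
  rw [cauchyThetaProd]
  refine prod_congr rfl fun j _ ↦ ?_
  simp only [map_neg, map_one]
  ring

/-- `φ(-X²)`-type Cauchy product: `∏_{j<K}(1 - X^{4j+2})²`. [folklore] -/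
theorem cauchyThetaProd_zero_two (K : ℕ) :
    cauchyThetaProd 0 2 (-1) K
      = ∏ j ∈ range K, ((1 - (X : ℤ⟦X⟧) ^ (4 * j + 2)) * (1 - X ^ (4 * j + 2))) := by
  rw [cauchyThetaProd]
  refine prod_congr rfl fun j _ ↦ ?_
  simp only [map_neg, map_one]
  ring

/-- `∏_{i<2K}(1 - X^{2(i+1)}) = ∏_{j<K}(1 - X^{4j+2}) · ∏_{j<K}(1 - X^{4(j+1)})`. [folklore] -/
theorem xPoch_two_two_mul (K : ℕ) :
    xPoch 2 (2 * K) = (∏ j ∈ range K, (1 - (X : ℤ⟦X⟧) ^ (4 * j + 2))) * xPoch 4 K := by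
  rw [xPoch, xPoch, prod_range_two_mul, ← prod_mul_distrib]
  exact prod_congr rfl fun j _ ↦ by ring

/-- Lengthening an Euler product does not change it modulo `X^D` once `c(K+1) ≥ D`. [folklore] -/
theorem eqMod_xPoch_add {c K r D : ℕ} (h : D ≤ c * (K + 1)) :
    EqMod D (xPoch c (K + r)) (xPoch c K) := by
  rw [xPoch, xPoch, prod_range_add]
  have htail := eqMod_prod_one_sub_X_pow (R := ℤ) (D := D) (range r) (fun i ↦ c * (K + i + 1))
    (fun i _ ↦ le_trans h (Nat.mul_le_mul_left _ (by omega)))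
  have h2 := (EqMod.refl D (∏ i ∈ range K, (1 - (X : ℤ⟦X⟧) ^ (c * (i + 1))))).mul htail
  rwa [mul_one] at h2

/-- Two power series congruent modulo every `X^(D+1)` are equal. [folklore] -/
theorem eq_of_forall_eqMod_succ {R : Type*} [CommRing R] {f g : R⟦X⟧}
    (h : ∀ D, EqMod (D + 1) f g) : f = g :=
  PowerSeries.ext fun d ↦ h d d (Nat.lt_succ_self d)

/-- **`ψ(X)·φ(-X) = ψ(-X)·φ(-X²)`** for `ψ(±X) = ∑_m (±1)^m X^{2m²+m}` and
`φ(-X^c) = ∑_k (-1)^k X^{ck²}`: modulo `X^D` both sides are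
`≡ (X⁴;X⁴)_{4D}² ∏_{i<4D}(1-X^{2i+1}) ∏_{j<4D}(1-X^{4j+2})²` by the four truncated triple products
(Jacobi: both sides equal `∏ (1-Xⁿ)(1-X²ⁿ)`; Tunnell's Remark, p. 327: "Jacobi noticed that
`g = q ∏ (1 - q^{8n})(1 - q^{16n})` and remarked on the two representations given in Theorem 1").
[cite: Tunnell1983Congruent, Remark p. 327] -/
theorem thetaSeries_psi_phi_eq :
    thetaSeries 1 1 1 * thetaSeries 0 1 (-1) = thetaSeries 1 1 (-1) * thetaSeries 0 2 (-1) := by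
  refine eq_of_forall_eqMod_succ fun D' ↦ ?_
  set D := D' + 1
  have hD : 0 < D := Nat.succ_pos D'
  have h1 := eqMod_xPoch_mul_cauchyThetaProd (b := 1) (e := 1) (s := 1) le_rfl (by norm_num) hD
    (N := 2 * D) (M := 4 * D) (by omega) (by omega)
  have h2 := eqMod_xPoch_mul_cauchyThetaProd (b := 1) (e := 1) (s := -1) le_rfl (by norm_num) hD
    (N := 2 * D) (M := 4 * D) (by omega) (by omega)
  have h3 := eqMod_xPoch_mul_cauchyThetaProd (b := 0) (e := 1) (s := -1) le_rfl (by norm_num) hD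
    (N := 4 * D) (M := 2 * (4 * D)) (by omega) (by omega)
  have h4 := eqMod_xPoch_mul_cauchyThetaProd (b := 0) (e := 2) (s := -1) (by norm_num)
    (by norm_num) hD
    (N := 4 * D) (M := 4 * D + 4 * D) (by omega) (by omega)
  rw [show 2 * (1 + 1) = 4 from rfl] at h1 h2
  rw [show 2 * (0 + 1) = 2 from rfl] at h3
  rw [show 2 * (0 + 2) = 4 from rfl] at h4
  have hE : EqMod D (xPoch 4 (4 * D)) (xPoch 4 (4 * D + 4 * D)) :=
    (eqMod_xPoch_add (by omega)).symm
  have hexact : xPoch 4 (4 * D) * cauchyThetaProd 1 1 1 (2 * D)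
        * (xPoch 2 (2 * (4 * D)) * cauchyThetaProd 0 1 (-1) (4 * D))
      = xPoch 4 (4 * D) * cauchyThetaProd 1 1 (-1) (2 * D)
        * (xPoch 4 (4 * D) * cauchyThetaProd 0 2 (-1) (4 * D)) := by
    have key : (∏ i ∈ range (4 * D), (1 + C (1 : ℤ) * (X : ℤ⟦X⟧) ^ (2 * i + 1)))
          * ∏ j ∈ range (4 * D), ((1 - (X : ℤ⟦X⟧) ^ (2 * j + 1)) * (1 - X ^ (2 * j + 1)))
        = (∏ i ∈ range (4 * D), (1 + C (-1 : ℤ) * (X : ℤ⟦X⟧) ^ (2 * i + 1)))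
          * ∏ j ∈ range (4 * D), (1 - (X : ℤ⟦X⟧) ^ (4 * j + 2)) := by
      rw [← prod_mul_distrib, ← prod_mul_distrib]
      refine prod_congr rfl fun j _ ↦ ?_
      simp only [map_neg, map_one]
      ring
    have hQ : ∏ j ∈ range (4 * D), ((1 - (X : ℤ⟦X⟧) ^ (4 * j + 2)) * (1 - X ^ (4 * j + 2)))
        = (∏ j ∈ range (4 * D), (1 - (X : ℤ⟦X⟧) ^ (4 * j + 2)))
          * ∏ j ∈ range (4 * D), (1 - (X : ℤ⟦X⟧) ^ (4 * j + 2)) := prod_mul_distrib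
    rw [cauchyThetaProd_one_one, cauchyThetaProd_one_one, cauchyThetaProd_zero_one,
      cauchyThetaProd_zero_two,
      xPoch_two_two_mul, show 2 * (2 * D) = 4 * D by ring]
    linear_combination (xPoch 4 (4 * D) * xPoch 4 (4 * D)
      * ∏ j ∈ range (4 * D), (1 - (X : ℤ⟦X⟧) ^ (4 * j + 2))) * key
      - (xPoch 4 (4 * D) * xPoch 4 (4 * D)
      * ∏ i ∈ range (4 * D), (1 + C (-1 : ℤ) * (X : ℤ⟦X⟧) ^ (2 * i + 1))) * hQ
  have hmid : EqMod D
      (xPoch 4 (4 * D) * cauchyThetaProd 1 1 1 (2 * D)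
        * (xPoch 2 (2 * (4 * D)) * cauchyThetaProd 0 1 (-1) (4 * D)))
      (xPoch 4 (4 * D) * cauchyThetaProd 1 1 (-1) (2 * D)
        * (xPoch 4 (4 * D + 4 * D) * cauchyThetaProd 0 2 (-1) (4 * D))) := by
    rw [hexact]
    exact (EqMod.refl _ _).mul (hE.mul (EqMod.refl _ _))
  exact ((h1.mul h3).symm.trans hmid).trans (h2.mul h4)

end Assembly

section Coefficients

/-! ### Coefficients of products of theta series, and the link to `c(n)`, `c'(n)` -/

variable {b e : ℕ}

/-- Modulo `X^{N+1}`, `θ_{a,b,s}` is the finite sum `∑_{|m| ≤ N} s^{|m|} X^{am²+bm}`. [folklore] -/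
theorem thetaSeries_eqMod_finsum (he : 1 ≤ e) (s : ℤ) (N : ℕ) :
    EqMod (N + 1) (thetaSeries b e s) (∑ m ∈ box N, C (s ^ m.natAbs) * X ^ thetaExp b e m) := by
  intro d hd
  rw [thetaSeries, coeff_mk, map_sum]
  simp only [coeff_C_mul, coeff_X_pow, mul_ite, mul_one, mul_zero]
  rw [← sum_filter]
  refine sum_congr ?_ fun _ _ ↦ rfl
  ext m
  simp only [Finset.mem_filter, mem_box_iff_natAbs_le]
  have hθ := cast_thetaExp b e m
  have hnat := natAbs_le_thetaExp b he m
  constructor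
  · rintro ⟨h1, h2⟩
    exact ⟨by omega, by omega⟩
  · rintro ⟨h1, h2⟩
    exact ⟨by omega, by omega⟩

/-- **Coefficients of a product of two theta series**: `[X^N] θ_{a,b,s} θ_{a',b',s'}
= ∑_{(m,k): (am²+bm) + (a'k²+b'k) = N} s^{|m|} s'^{|k|}`. [folklore] -/
theorem coeff_thetaSeries_mul {b' e' : ℕ} (he : 1 ≤ e) (he' : 1 ≤ e') (s s' : ℤ) (N : ℕ) :
    coeff N (thetaSeries b e s * thetaSeries b' e' s') =
      ∑ q ∈ (box N ×ˢ box N).filter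
          (fun q : ℤ × ℤ ↦ thetaExp b e q.1 + thetaExp b' e' q.2 = N),
        s ^ q.1.natAbs * s' ^ q.2.natAbs := by
  have h := (thetaSeries_eqMod_finsum (b := b) he s N).mul
    (thetaSeries_eqMod_finsum (b := b') he' s' N)
  rw [h N (Nat.lt_succ_self N), sum_mul_sum, map_sum, sum_filter, sum_product]
  refine sum_congr rfl fun m _ ↦ ?_
  rw [map_sum]
  refine sum_congr rfl fun k _ ↦ ?_
  rw [show C (s ^ m.natAbs) * (X : ℤ⟦X⟧) ^ thetaExp b e m
        * (C (s' ^ k.natAbs) * X ^ thetaExp b' e' k)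
      = C (s ^ m.natAbs * s' ^ k.natAbs) * X ^ (thetaExp b e m + thetaExp b' e' k) by
    rw [map_mul, pow_add]; ring, coeff_C_mul, coeff_X_pow]
  by_cases hN : thetaExp b e m + thetaExp b' e' k = N
  · rw [if_pos hN.symm, if_pos hN, mul_one]
  · rw [if_neg (Ne.symm hN), if_neg hN, mul_zero]

/-- The representations counted by `c(8N+1)` are the solutions of `(2m²+m) + k² = N` in the box.
[folklore] -/
theorem gRep_eight_mul_add_one (N : ℕ) :
    gRep (8 * N + 1) = (box N ×ˢ box N).filter
      (fun q : ℤ × ℤ ↦ thetaExp 1 1 q.1 + thetaExp 0 1 q.2 = N) := by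
  ext ⟨m, k⟩
  rw [mem_gRep, Finset.mem_filter, Finset.mem_product, mem_box_iff_natAbs_le,
    mem_box_iff_natAbs_le]
  dsimp only
  have h1 := cast_thetaExp 1 1 m
  have h2 := cast_thetaExp 0 1 k
  have hn1 := natAbs_le_thetaExp 1 (le_refl 1) m
  have hn2 := natAbs_le_thetaExp 0 (le_refl 1) k
  push_cast at h1 h2
  constructor
  · intro h
    have h' : 8 * ((2 : ℤ) * m ^ 2 + m + k ^ 2) = 8 * N := by linear_combination h
    have h'' : (2 : ℤ) * m ^ 2 + m + k ^ 2 = N := by linarith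
    refine ⟨⟨?_, ?_⟩, ?_⟩
    · omega
    · nlinarith [sq_nonneg m, sq_nonneg k, sq_abs k, Int.natAbs_mul_self' k]
    · omega
  · rintro ⟨-, h⟩
    have h' : ((thetaExp 1 1 m : ℕ) : ℤ) + thetaExp 0 1 k = N := by exact_mod_cast h
    rw [h1, h2] at h'
    linear_combination 8 * h'

/-- The representations counted by `c'(8N+1)` are the solutions of `(2m²+m) + 2k² = N` in the box.
[folklore] -/
theorem gRep'_eight_mul_add_one (N : ℕ) :
    gRep' (8 * N + 1) = (box N ×ˢ box N).filter
      (fun q : ℤ × ℤ ↦ thetaExp 1 1 q.1 + thetaExp 0 2 q.2 = N) := by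
  ext ⟨m, k⟩
  rw [mem_gRep', Finset.mem_filter, Finset.mem_product, mem_box_iff_natAbs_le,
    mem_box_iff_natAbs_le]
  dsimp only
  have h1 := cast_thetaExp 1 1 m
  have h2 := cast_thetaExp 0 2 k
  have hn1 := natAbs_le_thetaExp 1 (le_refl 1) m
  have hn2 := natAbs_le_thetaExp 0 (show 1 ≤ 2 by norm_num) k
  push_cast at h1 h2
  constructor
  · intro h
    have h' : 8 * ((2 : ℤ) * m ^ 2 + m + 2 * k ^ 2) = 8 * N := by linear_combination h
    have h'' : (2 : ℤ) * m ^ 2 + m + 2 * k ^ 2 = N := by linarith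
    refine ⟨⟨?_, ?_⟩, ?_⟩
    · omega
    · nlinarith [sq_nonneg m, sq_nonneg k, sq_abs k, Int.natAbs_mul_self' k]
    · omega
  · rintro ⟨-, h⟩
    have h' : ((thetaExp 1 1 m : ℕ) : ℤ) + thetaExp 0 2 k = N := by exact_mod_cast h
    rw [h1, h2] at h'
    linear_combination 8 * h'

/-- **`c(8N+1) = [X^N] ψ(X) φ(-X)`**: `c(8N+1) = ∑_{2m²+m+k²=N} (-1)^k`
((4m+1)² + 8k² = 8(2m²+m+k²) + 1). [cite: Tunnell1983Congruent, Thm 1] -/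
theorem gCoeff_eight_mul_add_one (N : ℕ) :
    gCoeff (8 * N + 1) = coeff N (thetaSeries 1 1 1 * thetaSeries 0 1 (-1)) := by
  rw [coeff_thetaSeries_mul (le_refl 1) (le_refl 1), gCoeff_def, gRep_eight_mul_add_one]
  exact sum_congr rfl fun q _ ↦ by rw [one_pow, one_mul]

/-- **`c'(8N+1) = [X^N] ψ(-X) φ(-X²)`**: `c'(8N+1) = ∑_{2m²+m+2k²=N} (-1)^{m+k}`
((4m+1)² + 16k² = 8(2m²+m+2k²) + 1). [cite: Tunnell1983Congruent, Thm 1] -/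
theorem gCoeff'_eight_mul_add_one (N : ℕ) :
    gCoeff' (8 * N + 1) = coeff N (thetaSeries 1 1 (-1) * thetaSeries 0 2 (-1)) := by
  rw [coeff_thetaSeries_mul (le_refl 1) (show 1 ≤ 2 by norm_num), gCoeff'_def,
    gRep'_eight_mul_add_one]
  exact sum_congr rfl fun q _ ↦ by rw [pow_add]

end Coefficients

end Literature.NumberTheory.EllipticCurves.Tunnell1983

namespace Literature.NumberTheory.EllipticCurves

open Tunnell1983 PowerSeries in
/-- **Tunnell 1983, Theorem 1 — the two `q`-expansions of `g` agree, PROVED**: `c'(n) = c(n)` for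
every `n ∈ ℤ`, i.e. `∑ (-1)^{m+n} q^{(4m+1)²+16n²} = ∑ (-1)ⁿ q^{(4m+1)²+8n²}` coefficientwise.
Proof (Jacobi's route, Remark p. 327): off `n ≡ 1 (8)`, `n ≥ 1` both vanish; at `n = 8N+1` the two
sides are the `N`-th coefficients of `ψ(-X)φ(-X²)` and `ψ(X)φ(-X)`, which agree by the truncated
triple-product expansions (`thetaSeries_psi_phi_eq`).
[cite: Tunnell1983Congruent, Thm 1 and Remark p. 327] -/
theorem Tunnell1983_gCoeff'_eq_gCoeff_holds : Tunnell1983_gCoeff'_eq_gCoeff := by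
  intro n
  by_cases h8 : n % 8 = 1
  · by_cases h1 : n < 1
    · rw [gCoeff_eq_zero_of_lt_one h1, gCoeff'_eq_zero_of_lt_one h1]
    · obtain ⟨N, rfl⟩ : ∃ N : ℕ, n = 8 * N + 1 := ⟨((n - 1) / 8).toNat, by omega⟩
      rw [gCoeff_eight_mul_add_one, gCoeff'_eight_mul_add_one, thetaSeries_psi_phi_eq]
  · rw [gCoeff_eq_zero_of_emod_eight_ne_one h8, gCoeff'_eq_zero_of_emod_eight_ne_one h8]

end Literature.NumberTheory.EllipticCurves
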